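import Summits.QuantumFields.BalabanUV.T4Continuum.Support.VariationalCovariantDirichletForm

/-!
# T⁴ programme, spine node NE2 (U1a), lane P2 — leaf REG⁺ of the variational route, file 3: THE COVARIANT BOCHNER STEP for 0-forms
# (Hessian and directional second covariant differences against the covariant Laplacian, commutators = plaquette defects),
# for the charged scalar (U(1) background = King's model), every torus
# (`t4/skeletons/NE2-t4-ne2-p2.md` v0.5 §2.C «REG⁺: covariant lattice Weitzenböck + Euler–Lagrange + UB⁺» / §7 supplier leaf s6;
# cell `pub-balaban`, NE2 formalisation swarm, leaf prover 09 gen 3)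

HONEST FRAMING (T4-DAG p. 1).  Rung (B)+1 only — NOT infinite volume, NOT a mass gap, NOT Clay.  Node NE2 is NOT IN PRINT and NOT
proved here.  MODEL LEVEL: UNIT-MODULUS bond phases `R` (data) on a torus `Tor N` with a PLAQUETTE DEFECT bound
`‖R(x,μ)R(x+e_μ,ν) − R(x,ν)R(x+e_ν,μ)‖ ≤ a` (data; for unit-modulus phases this is `|P_{μν}(x) − 1| ≤ a`); lattice units; scalar
(0-form) sector; ONE level.  What is proved is OURS and elementary (exact commutator identities + Cauchy–Schwarz in AM–GM form);
nothing printed is a hypothesis; no `def … : Prop` fact; no `sorry`; axioms standard.  The 1-form version of the identity is the tree's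
`Support/LatticeWeitzenbock` (p209345, abstract); this file is the concrete 0-form U(1) estimate the variational route consumes.
HONEST DEPENDENCY (cell, verbatim): continuum YM on T⁴ ⇐ BetaPertH ∧ nine spine estimates (0/9 proved); BetaPertH ⇐ (D1) ∧ (D4) ∧
CAP+tail; G-an2-4 gates asym, D1 and NE2/3/4.

THE STATEMENT.  With `D_μ f = cD R f · μ` (file 1's carriers; here as fields `Dir R μ f`), its formal adjoint `DirAdj R μ`
(`negLap R f = Σ_μ DirAdj μ (Dir μ f)`, `ip g (DirAdj μ h) = ip (Dir μ g) h`), the EXACT commutators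
`[D_ν, D_μ] g (x) = κ₂(x)·g(x+e_μ+e_ν)` (`Dir_comm`) and `[D_ν, D_μ†] g (x) = κ₁(x)·g(x−e_μ+e_ν)` (`Dir_DirAdj_comm`) with
`|κ₁|, |κ₂| ≤ a`, one gets for EVERY field `f` (`hessian_le`):

  `Σ_{μ,ν} nsq (D_μ D_ν f) ≤ 2·nsq (negLap R f) + 2ad·Σ_μ nsq (D_μ f) + a²d²·nsq f`,

and the directional second differences `Σ_ν nsq (D_ν†D_ν f)` (`= Σ_ν nsq (D_νD_ν f)`) obey the same bound (`directional_le`).  In physical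
units at level `n` (`×n^{4−d}`, `a ≍ α·n^{−2}` for the unit-smooth class): `ρ_Hess ≤ 2ρ_Lap + 2dα·Sc + d²α²·‖f‖²_{L²}` — so with file 2's
`ρ_Lap ≤ Λ·Sc` at the constrained minimiser and leaf P⁺, ANY second-difference regularity functional a ONE⁺ supplier chooses satisfies the
`hREG` shape of `VariationalCovariantAssembly.pair_bracket`, k-UNIFORMLY, with no NE3 and no propagator localisation.
-/

noncomputable section

namespace Summit.QuantumFields.BalabanUV.T4Continuum.VariationalCovariantBochner

open Finset
open scoped ComplexConjugate
open Literature.MathematicalPhysics.QuantumFieldTheory.Balaban1983to89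
open Literature.MathematicalPhysics.QuantumFieldTheory.Balaban1983to89.B5Prop11Plancherel (Tor unitVec)
open Literature.MathematicalPhysics.QuantumFieldTheory.Balaban1983to89.B5Prop11Lower (nsq nsq_nonneg)
open Summit.QuantumFields.BalabanUV.T4Continuum.VariationalCovariantFederbush (cD dirU)
open Summit.QuantumFields.BalabanUV.T4Continuum.VariationalCovariantDirichletForm (negLap)

variable {d : ℕ} (N : Fin d → ℕ) [∀ μ, NeZero (N μ)]

/-! ## §1 Directional covariant differences as operators on fields; adjoint; inner product -/

/-- `D_μ f` as a field: `(Dir R μ f)(x) = R(x,μ)f(x+e_μ) − f(x)`. [folklore] -/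
def Dir (R : Tor N → Fin d → ℂ) (μ : Fin d) (f : Tor N → ℂ) : Tor N → ℂ := fun x => cD N R f x μ

/-- the formal adjoint `(D_μ† g)(x) = conj R(x−e_μ,μ)·g(x−e_μ) − g(x)`. [folklore] -/
def DirAdj (R : Tor N → Fin d → ℂ) (μ : Fin d) (g : Tor N → ℂ) : Tor N → ℂ :=
  fun x => conj (R (x - unitVec N μ) μ) * g (x - unitVec N μ) - g x

/-- the `ℓ²` pairing `Σ_x conj(g x)·f x`. [folklore] -/
def ip (g f : Tor N → ℂ) : ℂ := ∑ x, conj (g x) * f x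

omit [∀ μ, NeZero (N μ)] in
/-- `Dir` unfolds to `cD`. [folklore] -/
theorem Dir_apply (R : Tor N → Fin d → ℂ) (μ : Fin d) (f : Tor N → ℂ) (x : Tor N) :
    Dir N R μ f x = R x μ * f (x + unitVec N μ) - f x := rfl

omit [∀ μ, NeZero (N μ)] in
/-- `negLap = Σ_μ D_μ† D_μ`. [folklore] -/
theorem negLap_eq (R : Tor N → Fin d → ℂ) (f : Tor N → ℂ) (x : Tor N) :
    negLap N R f x = ∑ μ, DirAdj N R μ (Dir N R μ f) x := rfl

/-- `ip f f = nsq f`. [folklore] -/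
theorem ip_self (f : Tor N → ℂ) : ip N f f = ((nsq f : ℝ) : ℂ) := by
  unfold ip nsq; push_cast
  exact sum_congr rfl fun x _ => Complex.conj_mul' _

/-- Hermitian symmetry of the pairing. [folklore] -/
theorem conj_ip (g f : Tor N → ℂ) : conj (ip N g f) = ip N f g := by
  unfold ip; rw [map_sum]
  exact sum_congr rfl fun x _ => by rw [map_mul, Complex.conj_conj, mul_comm]

/-- additivity of the pairing in the second slot over a finite sum of fields. [folklore] -/
theorem ip_sum_right {ι : Type*} (s : Finset ι) (g : Tor N → ℂ) (F : ι → Tor N → ℂ) :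
    ip N g (fun x => ∑ i ∈ s, F i x) = ∑ i ∈ s, ip N g (F i) := by
  unfold ip; rw [sum_comm]; exact sum_congr rfl fun x _ => by rw [mul_sum]

/-- `|ip g f| ≤ Σ |g||f|`. [folklore] -/
theorem norm_ip_le (g f : Tor N → ℂ) : ‖ip N g f‖ ≤ ∑ x, ‖g x‖ * ‖f x‖ := by
  unfold ip
  refine (norm_sum_le _ _).trans (sum_le_sum fun x _ => ?_)
  rw [norm_mul, Complex.norm_conj]

/-- **ADJOINTNESS** (exact, torus): `ip g (D_μ† h) = ip (D_μ g) h`. [folklore] -/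
theorem ip_DirAdj (R : Tor N → Fin d → ℂ) (μ : Fin d) (g h : Tor N → ℂ) :
    ip N g (DirAdj N R μ h) = ip N (Dir N R μ g) h := by
  unfold ip DirAdj Dir
  simp_rw [mul_sub, sum_sub_distrib]
  have htr : ∑ x, conj (g x) * (conj (R (x - unitVec N μ) μ) * h (x - unitVec N μ))
      = ∑ x, conj (g (x + unitVec N μ)) * (conj (R x μ) * h x) := by
    rw [← Equiv.sum_comp (Equiv.addRight (unitVec N μ))]
    exact sum_congr rfl fun x _ => by simp [add_sub_cancel_right]
  rw [htr, ← sum_sub_distrib]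
  refine sum_congr rfl fun x _ => ?_
  simp only [cD, map_sub, map_mul]; ring

omit [∀ μ, NeZero (N μ)] in
/-- `D_ν` is additive over finite sums of fields. [folklore] -/
theorem Dir_sum {ι : Type*} (R : Tor N → Fin d → ℂ) (ν : Fin d) (s : Finset ι) (F : ι → Tor N → ℂ) (x : Tor N) :
    Dir N R ν (fun y => ∑ i ∈ s, F i y) x = ∑ i ∈ s, Dir N R ν (F i) x := by
  simp only [Dir, cD, mul_sum, ← sum_sub_distrib]

/-! ## §2 The two exact commutators (curvature enters only here) -/

omit [∀ μ, NeZero (N μ)] in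
/-- **`[D_ν, D_μ] g (x) = (R(x,ν)R(x+e_ν,μ) − R(x,μ)R(x+e_μ,ν))·g(x+e_μ+e_ν)`** — the plaquette holonomy defect. [folklore] -/
theorem Dir_comm (R : Tor N → Fin d → ℂ) (μ ν : Fin d) (g : Tor N → ℂ) (x : Tor N) :
    Dir N R ν (Dir N R μ g) x - Dir N R μ (Dir N R ν g) x
      = (R x ν * R (x + unitVec N ν) μ - R x μ * R (x + unitVec N μ) ν) * g (x + unitVec N μ + unitVec N ν) := by
  simp only [Dir, cD]
  rw [add_right_comm x (unitVec N ν) (unitVec N μ)]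
  ring

omit [∀ μ, NeZero (N μ)] in
/-- **`[D_ν, D_μ†] g (x) = κ₁(x)·g(x−e_μ+e_ν)`**, `κ₁(x) = R(x,ν)·conj R(x−e_μ+e_ν,μ) − conj R(x−e_μ,μ)·R(x−e_μ,ν)`. [folklore] -/
theorem Dir_DirAdj_comm (R : Tor N → Fin d → ℂ) (μ ν : Fin d) (g : Tor N → ℂ) (x : Tor N) :
    Dir N R ν (DirAdj N R μ g) x - DirAdj N R μ (Dir N R ν g) x
      = (R x ν * conj (R (x - unitVec N μ + unitVec N ν) μ) - conj (R (x - unitVec N μ) μ) * R (x - unitVec N μ) ν)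
          * g (x - unitVec N μ + unitVec N ν) := by
  simp only [Dir, DirAdj, cD]
  rw [add_sub_right_comm x (unitVec N ν) (unitVec N μ)]
  ring

omit [∀ μ, NeZero (N μ)] in
/-- for unit-modulus phases `|κ₁(x)|` is the plaquette defect at `x − e_μ`. [folklore] -/
theorem norm_kappa1_le {R : Tor N → Fin d → ℂ} (hR1 : ∀ x μ, ‖R x μ‖ = 1) {a : ℝ}
    (hP : ∀ x μ ν, ‖R x μ * R (x + unitVec N μ) ν - R x ν * R (x + unitVec N ν) μ‖ ≤ a) (μ ν : Fin d) (x : Tor N) :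
    ‖R x ν * conj (R (x - unitVec N μ + unitVec N ν) μ) - conj (R (x - unitVec N μ) μ) * R (x - unitVec N μ) ν‖ ≤ a := by
  have u1 : R (x - unitVec N μ) μ * conj (R (x - unitVec N μ) μ) = 1 := by rw [Complex.mul_conj', hR1]; norm_num
  have u2 : R (x - unitVec N μ + unitVec N ν) μ * conj (R (x - unitVec N μ + unitVec N ν) μ) = 1 := by
    rw [Complex.mul_conj', hR1]; norm_num
  have key : (R x ν * conj (R (x - unitVec N μ + unitVec N ν) μ) - conj (R (x - unitVec N μ) μ) * R (x - unitVec N μ) ν)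
        * (R (x - unitVec N μ) μ * R (x - unitVec N μ + unitVec N ν) μ)
      = R (x - unitVec N μ) μ * R x ν - R (x - unitVec N μ) ν * R (x - unitVec N μ + unitVec N ν) μ := by
    linear_combination (R x ν * R (x - unitVec N μ) μ) * u2 - (R (x - unitVec N μ) ν * R (x - unitVec N μ + unitVec N ν) μ) * u1
  have hn : ‖R (x - unitVec N μ) μ * R (x - unitVec N μ + unitVec N ν) μ‖ = 1 := by rw [norm_mul, hR1, hR1, mul_one]
  have hPy := hP (x - unitVec N μ) μ ν
  rw [sub_add_cancel] at hPy
  calc ‖R x ν * conj (R (x - unitVec N μ + unitVec N ν) μ) - conj (R (x - unitVec N μ) μ) * R (x - unitVec N μ) ν‖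
      = ‖R x ν * conj (R (x - unitVec N μ + unitVec N ν) μ) - conj (R (x - unitVec N μ) μ) * R (x - unitVec N μ) ν‖
          * ‖R (x - unitVec N μ) μ * R (x - unitVec N μ + unitVec N ν) μ‖ := by rw [hn, mul_one]
    _ = ‖R (x - unitVec N μ) μ * R x ν - R (x - unitVec N μ) ν * R (x - unitVec N μ + unitVec N ν) μ‖ := by rw [← norm_mul, key]
    _ ≤ a := hPy

/-! ## §3 The two sides as sums of pairings, and the Bochner estimate -/

/-- `Σ_{μ,ν} nsq (D_μD_ν f) = Σ_{μ,ν} ip (D_ν f) (D_μ†D_μD_ν f)`. [folklore] -/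
theorem hessian_eq_sum_ip (R : Tor N → Fin d → ℂ) (f : Tor N → ℂ) :
    ((∑ μ, ∑ ν, nsq (Dir N R μ (Dir N R ν f)) : ℝ) : ℂ)
      = ∑ μ, ∑ ν, ip N (Dir N R ν f) (DirAdj N R μ (Dir N R μ (Dir N R ν f))) := by
  push_cast
  refine sum_congr rfl fun μ _ => sum_congr rfl fun ν _ => ?_
  rw [ip_DirAdj, ip_self]

/-- `nsq (negLap f) = Σ_{μ,ν} ip (D_ν f) (D_ν D_μ†D_μ f)` (the total is real, so it equals its conjugate). [folklore] -/
theorem nsq_negLap_eq_sum_ip (R : Tor N → Fin d → ℂ) (f : Tor N → ℂ) :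
    ((nsq (negLap N R f) : ℝ) : ℂ) = ∑ μ, ∑ ν, ip N (Dir N R ν f) (Dir N R ν (DirAdj N R μ (Dir N R μ f))) := by
  have h1 : ((nsq (negLap N R f) : ℝ) : ℂ) = ∑ ν, ip N (negLap N R f) (DirAdj N R ν (Dir N R ν f)) := by
    rw [← ip_self, ← ip_sum_right]; rfl
  have h2 : ∀ ν, ip N (negLap N R f) (DirAdj N R ν (Dir N R ν f))
      = ∑ μ, ip N (Dir N R ν (DirAdj N R μ (Dir N R μ f))) (Dir N R ν f) := by
    intro ν
    rw [ip_DirAdj]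
    have : Dir N R ν (negLap N R f) = fun x => ∑ μ, Dir N R ν (DirAdj N R μ (Dir N R μ f)) x := by
      funext x; rw [← Dir_sum]; rfl
    rw [this]
    unfold ip
    rw [sum_comm]
    exact sum_congr rfl fun x _ => by rw [map_sum, sum_mul]
  have h3 : ((nsq (negLap N R f) : ℝ) : ℂ) = ∑ μ, ∑ ν, ip N (Dir N R ν (DirAdj N R μ (Dir N R μ f))) (Dir N R ν f) := by
    rw [h1]; simp_rw [h2]; rw [sum_comm]
  calc ((nsq (negLap N R f) : ℝ) : ℂ) = conj (((nsq (negLap N R f) : ℝ) : ℂ)) := (Complex.conj_ofReal _).symm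
    _ = ∑ μ, ∑ ν, ip N (Dir N R ν f) (Dir N R ν (DirAdj N R μ (Dir N R μ f))) := by
        rw [h3, map_sum]
        refine sum_congr rfl fun μ _ => ?_
        rw [map_sum]
        exact sum_congr rfl fun ν _ => conj_ip N _ _

omit [∀ μ, NeZero (N μ)] in
/-- the operator identity behind Bochner: `D_ν D_μ†D_μ g − D_μ†D_μ D_ν g = [D_ν,D_μ†](D_μ g) + D_μ†([D_ν,D_μ] g)`, pointwise. [folklore] -/
theorem bochner_split (R : Tor N → Fin d → ℂ) (μ ν : Fin d) (g : Tor N → ℂ) (x : Tor N) :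
    Dir N R ν (DirAdj N R μ (Dir N R μ g)) x - DirAdj N R μ (Dir N R μ (Dir N R ν g)) x
      = (Dir N R ν (DirAdj N R μ (Dir N R μ g)) x - DirAdj N R μ (Dir N R ν (Dir N R μ g)) x)
        + DirAdj N R μ (fun y => Dir N R ν (Dir N R μ g) y - Dir N R μ (Dir N R ν g) y) x := by
  simp only [DirAdj]
  ring

/-- pointwise AM–GM in the two forms used: `u·(a·v) ≤ ½(a u² + a v²)` and `u·(a·v) ≤ ½(u² + a² v²)` (`a ≥ 0`). [folklore] -/
theorem mul_mul_le_half (u v : ℝ) {a : ℝ} (ha : 0 ≤ a) :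
    u * (a * v) ≤ (a * u ^ 2 + a * v ^ 2) / 2 ∧ u * (a * v) ≤ (u ^ 2 + a ^ 2 * v ^ 2) / 2 := by
  constructor
  · nlinarith [mul_nonneg ha (sq_nonneg (u - v))]
  · nlinarith [sq_nonneg (u - a * v)]

/-- translation invariance of `nsq`-type sums. [folklore] -/
theorem sum_sq_translate (g : Tor N → ℂ) (v : Tor N) : ∑ x, ‖g (x + v)‖ ^ 2 = ∑ x, ‖g x‖ ^ 2 :=
  Equiv.sum_comp (Equiv.addRight v) (fun x => ‖g x‖ ^ 2)

/-- the curvature error of the `(μ,ν)` term: `|ip (D_ν f) ([D_ν,D_μ†] D_μ f) + ip (D_μD_ν f) ([D_ν,D_μ] f)|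
≤ (a/2)(nsq D_ν f + nsq D_μ f) + ½ nsq (D_μD_ν f) + (a²/2) nsq f`. [folklore] -/
theorem error_term_le {R : Tor N → Fin d → ℂ} (hR1 : ∀ x μ, ‖R x μ‖ = 1) {a : ℝ} (ha : 0 ≤ a)
    (hP : ∀ x μ ν, ‖R x μ * R (x + unitVec N μ) ν - R x ν * R (x + unitVec N ν) μ‖ ≤ a) (μ ν : Fin d) (f : Tor N → ℂ) :
    ‖ip N (Dir N R ν f) (fun x => Dir N R ν (DirAdj N R μ (Dir N R μ f)) x - DirAdj N R μ (Dir N R ν (Dir N R μ f)) x)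
        + ip N (Dir N R μ (Dir N R ν f)) (fun y => Dir N R ν (Dir N R μ f) y - Dir N R μ (Dir N R ν f) y)‖
      ≤ a / 2 * (nsq (Dir N R ν f) + nsq (Dir N R μ f)) + nsq (Dir N R μ (Dir N R ν f)) / 2 + a ^ 2 / 2 * nsq f := by
  refine (norm_add_le _ _).trans ?_
  -- first pairing: the commutator `[D_ν, D_μ†]` applied to `D_μ f`
  have e1 : ‖ip N (Dir N R ν f) (fun x => Dir N R ν (DirAdj N R μ (Dir N R μ f)) x - DirAdj N R μ (Dir N R ν (Dir N R μ f)) x)‖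
      ≤ a / 2 * (nsq (Dir N R ν f) + nsq (Dir N R μ f)) := by
    refine (norm_ip_le N _ _).trans ?_
    have hpt : ∀ x, ‖Dir N R ν f x‖ * ‖Dir N R ν (DirAdj N R μ (Dir N R μ f)) x - DirAdj N R μ (Dir N R ν (Dir N R μ f)) x‖
        ≤ (a * ‖Dir N R ν f x‖ ^ 2 + a * ‖Dir N R μ f (x - unitVec N μ + unitVec N ν)‖ ^ 2) / 2 := by
      intro x
      rw [Dir_DirAdj_comm, norm_mul]
      have hk := norm_kappa1_le N hR1 hP μ ν x
      calc ‖Dir N R ν f x‖ * (‖R x ν * conj (R (x - unitVec N μ + unitVec N ν) μ) - conj (R (x - unitVec N μ) μ) * R (x - unitVec N μ) ν‖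
              * ‖Dir N R μ f (x - unitVec N μ + unitVec N ν)‖)
          ≤ ‖Dir N R ν f x‖ * (a * ‖Dir N R μ f (x - unitVec N μ + unitVec N ν)‖) :=
            mul_le_mul_of_nonneg_left (mul_le_mul_of_nonneg_right hk (norm_nonneg _)) (norm_nonneg _)
        _ ≤ _ := (mul_mul_le_half _ _ ha).1
    refine (sum_le_sum fun x _ => hpt x).trans (le_of_eq ?_)
    rw [← sum_div, sum_add_distrib, ← mul_sum, ← mul_sum]
    have htr : ∑ x, ‖Dir N R μ f (x - unitVec N μ + unitVec N ν)‖ ^ 2 = nsq (Dir N R μ f) := by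
      have := sum_sq_translate N (Dir N R μ f) (-unitVec N μ + unitVec N ν)
      unfold nsq; rw [← this]
      exact sum_congr rfl fun x _ => by rw [← add_assoc, ← sub_eq_add_neg]
    rw [htr]; unfold nsq; ring
  -- second pairing: the commutator `[D_ν, D_μ]` applied to `f`
  have e2 : ‖ip N (Dir N R μ (Dir N R ν f)) (fun y => Dir N R ν (Dir N R μ f) y - Dir N R μ (Dir N R ν f) y)‖
      ≤ nsq (Dir N R μ (Dir N R ν f)) / 2 + a ^ 2 / 2 * nsq f := by
    refine (norm_ip_le N _ _).trans ?_
    have hpt : ∀ x, ‖Dir N R μ (Dir N R ν f) x‖ * ‖Dir N R ν (Dir N R μ f) x - Dir N R μ (Dir N R ν f) x‖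
        ≤ (‖Dir N R μ (Dir N R ν f) x‖ ^ 2 + a ^ 2 * ‖f (x + unitVec N μ + unitVec N ν)‖ ^ 2) / 2 := by
      intro x
      rw [Dir_comm, norm_mul]
      have hk : ‖R x ν * R (x + unitVec N ν) μ - R x μ * R (x + unitVec N μ) ν‖ ≤ a := by rw [norm_sub_rev]; exact hP x μ ν
      calc ‖Dir N R μ (Dir N R ν f) x‖ * (‖R x ν * R (x + unitVec N ν) μ - R x μ * R (x + unitVec N μ) ν‖
              * ‖f (x + unitVec N μ + unitVec N ν)‖)
          ≤ ‖Dir N R μ (Dir N R ν f) x‖ * (a * ‖f (x + unitVec N μ + unitVec N ν)‖) :=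
            mul_le_mul_of_nonneg_left (mul_le_mul_of_nonneg_right hk (norm_nonneg _)) (norm_nonneg _)
        _ ≤ _ := (mul_mul_le_half _ _ ha).2
    refine (sum_le_sum fun x _ => hpt x).trans (le_of_eq ?_)
    rw [← sum_div, sum_add_distrib, ← mul_sum]
    have htr : ∑ x, ‖f (x + unitVec N μ + unitVec N ν)‖ ^ 2 = nsq f := by
      have := sum_sq_translate N f (unitVec N μ + unitVec N ν)
      unfold nsq; rw [← this]
      exact sum_congr rfl fun x _ => by rw [add_assoc]
    rw [htr]; unfold nsq; ring
  linarith

/-- **THE COVARIANT BOCHNER ESTIMATE (0-forms, U(1))**: for unit-modulus phases with plaquette defect `≤ a` and EVERY field `f`,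
`Σ_{μ,ν} nsq (D_μD_ν f) ≤ 2·nsq (D†D f) + 2ad·Σ_μ nsq (D_μ f) + a²d²·nsq f`.  At `a = 0` (flat, in particular `U = 1`):
`Σ‖∂_μ∂_ν f‖² ≤ 2‖Δf‖²` (the exact flat identity has constant 1; the factor 2 absorbs the curvature cross term in general). [folklore] -/
theorem hessian_le {R : Tor N → Fin d → ℂ} (hR1 : ∀ x μ, ‖R x μ‖ = 1) {a : ℝ} (ha : 0 ≤ a)
    (hP : ∀ x μ ν, ‖R x μ * R (x + unitVec N μ) ν - R x ν * R (x + unitVec N ν) μ‖ ≤ a) (f : Tor N → ℂ) :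
    ∑ μ, ∑ ν, nsq (Dir N R μ (Dir N R ν f))
      ≤ 2 * nsq (negLap N R f) + 2 * a * d * ∑ μ, nsq (Dir N R μ f) + a ^ 2 * d ^ 2 * nsq f := by
  set H : ℝ := ∑ μ, ∑ ν, nsq (Dir N R μ (Dir N R ν f)) with hH
  set L : ℝ := nsq (negLap N R f) with hL
  -- the difference of the two complex representations is the sum of the error terms
  set E : Fin d → Fin d → ℂ := fun μ ν =>
    ip N (Dir N R ν f) (fun x => Dir N R ν (DirAdj N R μ (Dir N R μ f)) x - DirAdj N R μ (Dir N R ν (Dir N R μ f)) x)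
      + ip N (Dir N R μ (Dir N R ν f)) (fun y => Dir N R ν (Dir N R μ f) y - Dir N R μ (Dir N R ν f) y) with hE
  have hdiff : ((L : ℝ) : ℂ) - ((H : ℝ) : ℂ) = ∑ μ, ∑ ν, E μ ν := by
    rw [hL, hH, nsq_negLap_eq_sum_ip, hessian_eq_sum_ip, ← sum_sub_distrib]
    refine sum_congr rfl fun μ _ => ?_
    rw [← sum_sub_distrib]
    refine sum_congr rfl fun ν _ => ?_
    -- `ip (Dνf) (Dν D†μ Dμ f) − ip (Dνf) (D†μ Dμ Dν f) = ip (Dνf) ([Dν,D†μ] Dμ f) + ip (Dνf)(D†μ [Dν,Dμ] f)` and adjointness on the last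
    have hsplit : ip N (Dir N R ν f) (Dir N R ν (DirAdj N R μ (Dir N R μ f))) - ip N (Dir N R ν f) (DirAdj N R μ (Dir N R μ (Dir N R ν f)))
        = ip N (Dir N R ν f) (fun x => Dir N R ν (DirAdj N R μ (Dir N R μ f)) x - DirAdj N R μ (Dir N R ν (Dir N R μ f)) x)
          + ip N (Dir N R ν f) (DirAdj N R μ (fun y => Dir N R ν (Dir N R μ f) y - Dir N R μ (Dir N R ν f) y)) := by
      unfold ip
      rw [← sum_sub_distrib, ← sum_add_distrib]
      refine sum_congr rfl fun x _ => ?_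
      rw [← mul_sub, ← mul_add, bochner_split]
    rw [hsplit, hE, ip_DirAdj]
  -- bound the error terms
  have hEle : ∀ μ ν, ‖E μ ν‖ ≤ a / 2 * (nsq (Dir N R ν f) + nsq (Dir N R μ f)) + nsq (Dir N R μ (Dir N R ν f)) / 2 + a ^ 2 / 2 * nsq f :=
    fun μ ν => error_term_le N hR1 ha hP μ ν f
  have hsumE : ‖∑ μ, ∑ ν, E μ ν‖ ≤ a * d * ∑ μ, nsq (Dir N R μ f) + H / 2 + a ^ 2 * d ^ 2 / 2 * nsq f := by
    calc ‖∑ μ, ∑ ν, E μ ν‖ ≤ ∑ μ, ∑ ν, ‖E μ ν‖ := (norm_sum_le _ _).trans (sum_le_sum fun μ _ => norm_sum_le _ _)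
      _ ≤ ∑ μ, ∑ ν, (a / 2 * (nsq (Dir N R ν f) + nsq (Dir N R μ f)) + nsq (Dir N R μ (Dir N R ν f)) / 2 + a ^ 2 / 2 * nsq f) :=
          sum_le_sum fun μ _ => sum_le_sum fun ν _ => hEle μ ν
      _ = a * d * ∑ μ, nsq (Dir N R μ f) + H / 2 + a ^ 2 * d ^ 2 / 2 * nsq f := by
          simp only [sum_add_distrib, mul_add, ← mul_sum, ← sum_div, sum_const, card_univ, Fintype.card_fin, nsmul_eq_mul]
          ring
  -- real parts
  have hre : L - H = (∑ μ, ∑ ν, E μ ν).re := by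
    have h := congrArg Complex.re hdiff
    simp only [Complex.sub_re, Complex.ofReal_re] at h
    exact h
  have habs : H - L ≤ ‖∑ μ, ∑ ν, E μ ν‖ := by
    have h := Complex.abs_re_le_norm (∑ μ, ∑ ν, E μ ν)
    rw [← hre] at h
    linarith [(abs_le.mp h).1]
  linarith

/-- for unit-modulus phases `‖D_ν† g‖² = ‖D_ν g‖²` (the adjoint difference is a transported, translated forward difference). [folklore] -/
theorem nsq_DirAdj_eq {R : Tor N → Fin d → ℂ} (hR1 : ∀ x μ, ‖R x μ‖ = 1) (ν : Fin d) (g : Tor N → ℂ) :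
    nsq (DirAdj N R ν g) = nsq (Dir N R ν g) := by
  have hpt : ∀ x, ‖DirAdj N R ν g x‖ = ‖Dir N R ν g (x - unitVec N ν)‖ := by
    intro x
    have u : conj (R (x - unitVec N ν) ν) * R (x - unitVec N ν) ν = 1 := by rw [Complex.conj_mul', hR1]; norm_num
    have e : DirAdj N R ν g x = -(conj (R (x - unitVec N ν) ν)) * Dir N R ν g (x - unitVec N ν) := by
      simp only [DirAdj, Dir, cD, sub_add_cancel]
      linear_combination (g x) * u
    rw [e, norm_mul, norm_neg, Complex.norm_conj, hR1, one_mul]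
  unfold nsq
  simp_rw [hpt]
  have := sum_sq_translate N (Dir N R ν g) (-unitVec N ν)
  simp_rw [← sub_eq_add_neg] at this
  exact this

/-- **DIRECTIONAL FORM**: `Σ_ν nsq (D_ν†D_ν f) ≤ 2·nsq (D†D f) + 2ad·Σ_μ nsq (D_μ f) + a²d²·nsq f` (the directional second covariant
differences `Δ^R_ν f = −D_ν†D_ν f` are the diagonal of the Hessian sum). [folklore] -/
theorem directional_le {R : Tor N → Fin d → ℂ} (hR1 : ∀ x μ, ‖R x μ‖ = 1) {a : ℝ} (ha : 0 ≤ a)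
    (hP : ∀ x μ ν, ‖R x μ * R (x + unitVec N μ) ν - R x ν * R (x + unitVec N ν) μ‖ ≤ a) (f : Tor N → ℂ) :
    ∑ ν, nsq (DirAdj N R ν (Dir N R ν f))
      ≤ 2 * nsq (negLap N R f) + 2 * a * d * ∑ μ, nsq (Dir N R μ f) + a ^ 2 * d ^ 2 * nsq f := by
  refine le_trans ?_ (hessian_le N hR1 ha hP f)
  calc ∑ ν, nsq (DirAdj N R ν (Dir N R ν f)) = ∑ ν, nsq (Dir N R ν (Dir N R ν f)) :=
        sum_congr rfl fun ν _ => nsq_DirAdj_eq N hR1 ν _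
    _ ≤ ∑ μ, ∑ ν, nsq (Dir N R μ (Dir N R ν f)) :=
        sum_le_sum fun μ _ => single_le_sum (f := fun ν => nsq (Dir N R μ (Dir N R ν f))) (fun ν _ => nsq_nonneg _) (mem_univ μ)

/-- the directional Dirichlet sums of file 1's carriers: `Σ_μ nsq (Dir μ f) = Σ_μ dirU R f μ`. [folklore] -/
theorem sum_nsq_Dir_eq (R : Tor N → Fin d → ℂ) (f : Tor N → ℂ) : ∑ μ, nsq (Dir N R μ f) = ∑ μ, dirU N R f μ := rfl

end Summit.QuantumFields.BalabanUV.T4Continuum.VariationalCovariantBochner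

end
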